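import Summits.QuantumAdvantage.QuantumAdvantage.Theorems.CubicForrelationNearExactIsExactTwelveTypeOGe5964

/-!
# Crux `CubicForrelation.NearExactIsExact` (stmt-QuantumAdvantage-14043) — n = 12, type O below `59/64`: the 9-flat base pattern (`#E = 512`)
  needs `Φ ≤ 931/1024`

Certificate seat `b2b-cforr-cert` (gen 15).  HONEST FRAMING: a kernel-checked lemma (standard axioms) about cubic Boolean pairs on 12 bits — a
structure result for the open values `933/1024 … 943/1024` of `θ₁₂`: a TYPE-O side there has `#E ≥ 768` (`E = {d₁ = d₂}` the support of the
base pattern's cubic).  NOT summit progress.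

`to15_typeO_E_ge_768`: cubic `f, g`, `W_g = 16u`, some `u(x)` odd, `Φ(f,g) > 931/1024` ⇒ `#E ≥ 768`.  Proof: otherwise `#E = 512` (second weight),
`E` is a 9-flat, and gen 12's relative 2-adic tower (`to12_cube_congr`, `to12_level`, `to12_excess`) runs with the excess budget
`X = 2¹⁷(1 − Φ) − 8192 < 3712`: `[v odd]` would cost `256·16`, `[v/2 odd]` `64·160`, `[v/4 odd]` `8·832`, a point with `|v| ≥ 8` `3712` — all
`> X`; so `v ≡ 0`, `Σ τ² = 8192`, `Φ = 15/16`, contradicting `to12_typeO_le` (`Φ ≤ 59/64`).  Gen 12 recorded this threshold ("`1024Φ ∈ {960} ∪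
{931, 929} ∪ …`") without formalising it.

References: Ax (1964) / McEliece (1972); Kasami–Tokura (1970); MacWilliams–Sloane (1977) Ch. 13–15; O'Donnell (2014) §3.3.  Axioms: standard.
-/

set_option linter.dupNamespace false -- D-0017: single-problem summit ⇒ `QuantumAdvantage.QuantumAdvantage` by design

noncomputable section

namespace Summit.QuantumAdvantage.QuantumAdvantage.Theorems.CubicForrelation.NearExactIsExact

open Finset
open Literature.Computability.QuantumComplexity
open Literature.Computability.QuantumComplexity.BuzetChailloux (bxor zeroVec bxor_bxor_cancel_left bxor_zeroVec zeroVec_bxor bxor_comm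
  bxor_self twist_zeroVec_right twist_bxor_right signOf_sq)
open Literature.Computability.QuantumComplexity.DerivativeWalsh (W sum_W_sq)
open Summit.QuantumAdvantage.QuantumAdvantage.Theorems.NearExactIsExact.Negative (TypeOTwelve.no_caseA TypeOTwelve.cube_sum_dvd
  TypeOTwelve.typeO_of_exists_odd)
open Summit.QuantumAdvantage.QuantumAdvantage.Theorems.SignedCubicForrelationNotPrBPP (knf_isDegLeFun_ip)

/-! ### The theorem -/

/-- **Type O with `Φ > 931/1024` on 12 bits has `#E ≥ 768`.**  Cubic `f, g : 𝔽₂¹² → 𝔽₂` with `W_g = 16u`, some `u(x)` odd and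
`Φ(f,g) > 931/1024`: the set `E = {x : [⌊u/2⌋ odd] = [⌊u/4⌋ odd]}` has at least `768` points (the 9-flat case `#E = 512` dies by gen 12's
tower with excess `< 3712`).  Finite-slice statement; NOT summit progress. [this work] -/
theorem to15_typeO_E_ge_768 (f g : (Fin (6 + 6) → Bool) → Bool) (hf : IsDegLeFun 3 f) (hg : IsDegLeFun 3 g)
    (u : (Fin (6 + 6) → Bool) → ℤ) (hu : ∀ x, W (fun y => signOf (g y)) x = (2 : ℝ) ^ 4 * (u x : ℝ))
    (hodd : ∃ x, Odd (u x)) (hΦ : (931 / 1024 : ℝ) < forrelation f g) :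
    768 ≤ #(univ.filter fun x : Fin (6 + 6) → Bool => (Odd (u x / 2) ↔ Odd (u x / 2 / 2))) := by
  classical
  have hΦle : forrelation f g ≤ 59 / 64 := to12_typeO_le f g hf hg u hu hodd
  by_contra hElt
  push Not at hElt
  have hall : ∀ x, Odd (u x) := TypeOTwelve.typeO_of_exists_odd g u hg hu hodd
  have hu' : ∀ x, W (fun y => signOf (g y)) x = (2 : ℝ) ^ (2 * 2) * (u x : ℝ) := fun x => (hu x).trans (by norm_num)
  have hd1 : IsDegLeFun 1 (fun x => decide (Odd (u x / 2))) := z2_digitOne 2 g u hg hu' hall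
  have hd2 : IsDegLeFun 3 (fun x => decide (Odd (u x / 2 / 2))) := z2_digitTwo 2 g u hg hu' hall
  -- case A (all `u ≡ ±3 (mod 8)`) is empty
  have hnoA : ¬ (∀ x, ¬ (Odd (u x / 2) ↔ Odd (u x / 2 / 2))) := by
    intro h
    refine TypeOTwelve.no_caseA g u hg hu fun x => ?_
    have h0 := Int.odd_iff.1 (hall x)
    have hx := h x
    rw [Int.odd_iff, Int.odd_iff] at hx
    omega
  set E := univ.filter (fun x : Fin (6 + 6) → Bool => (Odd (u x / 2) ↔ Odd (u x / 2 / 2))) with hEdef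
  have hmemE : ∀ x, x ∈ E ↔ (Odd (u x / 2) ↔ Odd (u x / 2 / 2)) := fun x => by simp [hEdef]
  have hdegE : IsDegLeFun (2 + 1) (fun x => (decide (Odd (u x / 2)) ^^ decide (Odd (u x / 2 / 2))) ^^ true) :=
    tb_isDegLeFun_xor_const (bb_isDegLeFun_bxor (hd1.mono (by norm_num)) hd2) true
  have hsetE : (univ.filter fun x : Fin (6 + 6) → Bool =>
      ((decide (Odd (u x / 2)) ^^ decide (Odd (u x / 2 / 2))) ^^ true) = true) = E := by
    rw [hEdef]
    apply filter_congr
    intro x _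
    by_cases h1 : Odd (u x / 2) <;> by_cases h2 : Odd (u x / 2 / 2) <;> simp [h1, h2]
  have hne : ∃ x, ((decide (Odd (u x / 2)) ^^ decide (Odd (u x / 2 / 2))) ^^ true) = true := by
    by_contra hnone
    push Not at hnone
    refine hnoA fun x => ?_
    have hx := hnone x
    by_cases h1 : Odd (u x / 2) <;> by_cases h2 : Odd (u x / 2 / 2) <;> simp [h1, h2] at hx ⊢
  have hsumE : (∑ x, (if (Odd (u x / 2) ↔ Odd (u x / 2 / 2)) then 1 else 0 : ℤ)) = #E := by rw [sum_boole]
  -- budget `Σ τ² = 2¹⁷(1 − Φ) < 11904`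
  have hbud := tw12_budget f g u hu
  have hT : (∑ x, (u x - 4 * sZ (f x)) ^ 2 : ℤ) ≤ 11903 := by
    have h' : ((∑ x, (u x - 4 * sZ (f x)) ^ 2 : ℤ) : ℝ) < 11904 := by rw [hbud]; linarith
    have h'' : (∑ x, (u x - 4 * sZ (f x)) ^ 2 : ℤ) < 11904 := by exact_mod_cast h'
    omega
  -- base pattern `τ₀` and wild function `v`: `τ = τ₀ + 8v`
  choose v hv using fun x => to12_pt_mod8 (u x) (sZ (f x)) (hall x) (tp_sZ_cases (f x))
  set τ₀ : (Fin (6 + 6) → Bool) → ℤ := fun x =>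
    sZ (decide (Odd (u x / 2))) * (1 - 4 * (if (Odd (u x / 2) ↔ Odd (u x / 2 / 2)) then 1 else 0)) with hτ₀def
  have hvx : ∀ x, u x - 4 * sZ (f x) = τ₀ x + 8 * v x := fun x => hv x
  have hτ₀val : ∀ x, τ₀ x = 1 ∨ τ₀ x = -1 ∨ τ₀ x = 3 ∨ τ₀ x = -3 := by
    intro x
    simp only [τ₀]
    rcases tp_sZ_cases (decide (Odd (u x / 2))) with h | h <;> rw [h] <;> split_ifs <;> norm_num
  have hτ₀sq : ∀ x, τ₀ x ^ 2 = 1 + 8 * (if (Odd (u x / 2) ↔ Odd (u x / 2 / 2)) then 1 else 0 : ℤ) := by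
    intro x
    simp only [τ₀]
    rcases tp_sZ_cases (decide (Odd (u x / 2))) with h | h <;> rw [h] <;> split_ifs <;> norm_num
  have hsumτ₀ : ∑ x, τ₀ x ^ 2 = 4096 + 8 * #E := by
    rw [sum_congr rfl fun x _ => hτ₀sq x, sum_add_distrib, ← mul_sum, hsumE, sum_const, card_univ, Fintype.card_fun,
      Fintype.card_bool, Fintype.card_fin]
    norm_num
  -- excess decomposition `Σ τ² = Σ τ₀² + Σ X`, `X ≥ 0`
  set X : (Fin (6 + 6) → Bool) → ℤ := fun x => (τ₀ x + 8 * v x) ^ 2 - τ₀ x ^ 2 with hXdef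
  have hXnn : ∀ x, 0 ≤ X x := fun x => to12_excess_nonneg _ _ (hτ₀val x)
  have hTdec : (∑ x, (u x - 4 * sZ (f x)) ^ 2 : ℤ) = ∑ x, τ₀ x ^ 2 + ∑ x, X x := by
    rw [← sum_add_distrib]
    exact sum_congr rfl fun x _ => by rw [hvx x]; simp only [X]; ring
  have hXsum_nn : 0 ≤ ∑ x, X x := sum_nonneg fun x _ => hXnn x
  change #E < 768 at hElt
  -- `#E = 512`: gen 12's tower with excess budget `< 3712`
  have hE16 : 16 * #E < 3 * 2 ^ (6 + 6) := by norm_num; omega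
  have hE512 : #E = 512 := by
    have h := sw_cubic_second_weight (m := 6 + 6) _ hdegE hne (by rw [hsetE]; exact hE16)
    rw [hsetE] at h
    norm_num at h
    omega
  have hXsum : ∑ x, X x ≤ 3711 := by
    have : (∑ x, (u x - 4 * sZ (f x)) ^ 2 : ℤ) = 8192 + ∑ x, X x := by rw [hTdec, hsumτ₀, hE512]; norm_num
    linarith
  -- `E` is a 9-flat
  have hmwE := mw_flat_of_minweight 2 _ hdegE (by rw [hsetE, hE512]; norm_num)
  rw [hsetE] at hmwE
  obtain ⟨h0E, haddE, hcardVE, hcosetE⟩ := hmwE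
  set VE := univ.filter (fun a : Fin (6 + 6) → Bool => ∀ x,
    ((decide (Odd (u (bxor x a) / 2)) ^^ decide (Odd (u (bxor x a) / 2 / 2))) ^^ true) =
      ((decide (Odd (u x / 2)) ^^ decide (Odd (u x / 2 / 2))) ^^ true)) with hVE
  rw [hE512] at hcardVE
  have hEpos : 0 < #E := by rw [hE512]; norm_num
  obtain ⟨xE, hxE⟩ : E.Nonempty := card_pos.1 hEpos
  have hSE : E = VE.image (bxor xE) := hcosetE xE (by
    have h := (hmemE xE).1 hxE
    by_cases h1 : Odd (u xE / 2)
    · have h2 : Odd (u xE / 2 / 2) := h.1 h1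
      simp [h1, h2]
    · have h2 : ¬ Odd (u xE / 2 / 2) := fun h' => h1 (h.2 h')
      simp [h1, h2])
  -- the wild identity in coset form
  have hv' : ∀ x, u x - 4 * sZ (f x) =
      sZ (decide (Odd (u x / 2))) * (1 - 4 * (if x ∈ VE.image (bxor xE) then 1 else 0)) + 8 * v x := by
    intro x
    rw [← hSE, hvx x]
    simp only [τ₀]
    by_cases hx : (Odd (u x / 2) ↔ Odd (u x / 2 / 2))
    · rw [if_pos hx, if_pos ((hmemE x).2 hx)]
    · rw [if_neg hx, if_neg (fun h' => hx ((hmemE x).1 h'))]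
  have hcc := fun I => to12_cube_congr f g hf hg u hu hd1 VE xE h0E haddE hcardVE v hv' I
  -- excess of a set of wild points
  have hXset : ∀ (S : Finset (Fin (6 + 6) → Bool)) (c : ℤ), 1 ≤ c → (∀ x ∈ S, c ≤ v x ∨ v x ≤ -c) →
      16 * c * (4 * c - 3) * #S ≤ ∑ x, X x := by
    intro S c hc hS
    calc 16 * c * (4 * c - 3) * #S = ∑ x ∈ S, 16 * c * (4 * c - 3) := by rw [sum_const, nsmul_eq_mul, mul_comm]
      _ ≤ ∑ x ∈ S, X x := sum_le_sum fun x hx => to12_excess _ _ c (hτ₀val x) hc (hS x hx)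
      _ ≤ ∑ x, X x := sum_le_sum_of_subset_of_nonneg (subset_univ _) fun x _ _ => hXnn x
  -- LEVEL 1: `v` is even
  have hv2 : ∀ x, Even (v x) := by
    rcases to12_level v 4 (fun I hI => (hcc I).1 (by omega)) with h | h
    · exact h
    · exfalso
      have hcnt : (256 : ℤ) ≤ #(univ.filter fun x => Odd (v x)) := by norm_num at h; exact_mod_cast (by omega)
      have hge := hXset (univ.filter fun x => Odd (v x)) 1 le_rfl (fun x hx => by
        obtain ⟨k, hk⟩ := (mem_filter.1 hx).2; omega)
      linarith
  choose v₁ hv₁ using hv2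
  have hvv₁ : ∀ x, v x = 2 * v₁ x := fun x => by rw [two_mul]; exact hv₁ x
  -- LEVEL 2: `v/2` is even
  have hv4 : ∀ x, Even (v₁ x) := by
    rcases to12_level v₁ 6 (fun I hI => by
      have h4 := (hcc I).2.1 (by omega)
      rw [sum_congr rfl (fun x _ => hvv₁ x), ← mul_sum] at h4
      omega) with h | h
    · exact h
    · exfalso
      have hcnt : (64 : ℤ) ≤ #(univ.filter fun x => Odd (v₁ x)) := by norm_num at h; exact_mod_cast (by omega)
      have hge := hXset (univ.filter fun x => Odd (v₁ x)) 2 (by norm_num) (fun x hx => by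
        obtain ⟨k, hk⟩ := (mem_filter.1 hx).2; have := hvv₁ x; omega)
      linarith
  choose v₂ hv₂ using hv4
  have hvv₂ : ∀ x, v x = 4 * v₂ x := fun x => by rw [hvv₁ x, hv₂ x]; ring
  -- LEVEL 3: `v/4` is even
  have hv8 : ∀ x, Even (v₂ x) := by
    rcases to12_level v₂ 9 (fun I hI => by
      have h8 := (hcc I).2.2 (by omega)
      rw [sum_congr rfl (fun x _ => hvv₂ x), ← mul_sum] at h8
      omega) with h | h
    · exact h
    · exfalso
      have hcnt : (8 : ℤ) ≤ #(univ.filter fun x => Odd (v₂ x)) := by norm_num at h; exact_mod_cast (by omega)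
      have hge := hXset (univ.filter fun x => Odd (v₂ x)) 4 (by norm_num) (fun x hx => by
        obtain ⟨k, hk⟩ := (mem_filter.1 hx).2; have := hvv₂ x; omega)
      linarith
  -- LEVEL 4: no wild point at all
  have hv0 : ∀ x, v x = 0 := by
    intro x
    by_contra hx
    have h8 : 8 ≤ v x ∨ v x ≤ -8 := by obtain ⟨k, hk⟩ := hv8 x; have := hvv₂ x; omega
    have h1 := to12_excess _ _ 8 (hτ₀val x) (by norm_num) h8
    have h2 : X x ≤ ∑ y, X y := single_le_sum (fun y _ => hXnn y) (mem_univ x)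
    simp only [X] at h2
    linarith
  -- hence `Σ τ² = 8192`, `Φ = 15/16 > 59/64`
  have hT8192 : (∑ x, (u x - 4 * sZ (f x)) ^ 2 : ℤ) = 8192 := by
    rw [hTdec, hsumτ₀, hE512, sum_eq_zero (fun x _ => by simp only [X]; rw [hv0 x]; ring)]
    norm_num
  have hΦeq : forrelation f g = 15 / 16 := by
    have h : ((∑ x, (u x - 4 * sZ (f x)) ^ 2 : ℤ) : ℝ) = 8192 := by exact_mod_cast hT8192
    rw [hbud] at h
    linarith
  rw [hΦeq] at hΦle
  norm_num at hΦle

end Summit.QuantumAdvantage.QuantumAdvantage.Theorems.CubicForrelation.NearExactIsExact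

end
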